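import Summits.QuantumAdvantage.QuantumAdvantage.Theorems.SteerDialState

/-!
# SteerDial (15): SteerDialHeavy — the covering dichotomy REDUCED to a list-free, word-free single-ring statement

Part 15 of the prover-side twin of the lineage decomp-qadv-lens-5 steering programme, generation 9, workshop node
«TagDial» rev 7 §12.  The randomness half of part 14 is completely general: for EVERY event `E ⊆ C_n`, every orbit
fraction `θ/(θ+1) < 1` and every `T`, some rotation list of length `T` leaves at most `(θ/(θ+1))^T·2ⁿ` strings that are
orbit-light for `E` and yet have all listed rotations in `E` (`exists_rotList₂`, averaging over all `n^T` lists).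
Fixing the insertion word `W0` turns any test `ψ` on `C_{n+6}` into the body event `{y : ψ(pad W0 y) ≠ 1}` of the same
degree (the landed `comp_pad_mem_lowDegG`) and sparsity `≤ 2⁶·η`.  Hence the strategy-free covering dichotomy of part 11 FOLLOWS from
the ORBIT-HEAVY HULL statement — «every `η`-sparse event of degree `≤ (log₂ n)^c` on one ring admits a rotation-invariant
`φ` of degree `≤ (log₂ n)^{c'}`, `(1 − η_I)`-dense, missing all but `2ⁿ/n^{k'}` of the strings whose orbit spends a
fraction `≥ θ/(θ+1)` in the event» — with no window, no word, no certificate and no rotation list: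
`steerDial_invModCover3_of_heavyCover3` (`η := η_H/64`, `m := 6`, words `W0`, `c₁ := 2`, `T := θ(k'(L+1)+1)`, Bernoulli
`two_mul_pow_le_succ_pow`, `(log₂(n+6))^c ≤ (log₂ n)^{2c}` `log_pad_le`).
No `def … : Prop`, no `instance`, no `notation`.
-/

set_option linter.style.longLine false
set_option linter.dupNamespace false

namespace Summit.QuantumAdvantage.QuantumAdvantage.Theorems.SteerDial

open Finset
open Literature.Computability.QuantumComplexity Literature.Computability.MetaComplexity
open Literature.Computability.QuantumComplexity.RingHLF
open Summit.QuantumAdvantage.AdviceFreeQNC0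
open Summit.QuantumAdvantage.QuantumAdvantage.Theses

/-! ## The hinge from the ORBIT-HEAVY HULL (workshop node «TagDial» rev 7 §12) -/

section Heavy

variable {n m : ℕ}

/-- RANDOM LISTS at orbit fraction `b/a`: some rotation list of length `T` leaves at most `(b/a)^T·2ⁿ` strings
that are `(a,b)`-LIGHT for `E` (`a·rcnt < b·n`) and yet have all listed rotations in `E` (averaging over all `n^T`
lists; `exists_rotList` is the case `b = 1`). -/
theorem exists_rotList₂ (a b : ℕ) (hn : 0 < n) (E : Finset (Fin n → Bool)) (T : ℕ) :
    ∃ r : Fin T → ℕ, a ^ T * (univ.filter fun y : Fin n → Bool =>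
        ¬ b * n ≤ a * rcnt E y ∧ ∀ t, rot (r t) y ∈ E).card ≤ b ^ T * 2 ^ n := by
  classical
  set cnt : (Fin T → Fin n) → ℕ := fun r =>
    (univ.filter fun y : Fin n → Bool => ¬ b * n ≤ a * rcnt E y ∧ ∀ t, rot (r t).val y ∈ E).card with hcnt
  have hswap : ∑ r, cnt r =
      ∑ y ∈ univ.filter (fun y : Fin n → Bool => ¬ b * n ≤ a * rcnt E y), rcnt E y ^ T := by
    simp only [hcnt, Finset.card_filter]
    rw [Finset.sum_comm, Finset.sum_filter]
    refine Finset.sum_congr rfl fun y _ => ?_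
    by_cases hl : b * n ≤ a * rcnt E y
    · simp only [hl, not_true_eq_false, false_and, if_false, Finset.sum_const_zero]
    · simp only [hl, not_false_eq_true, true_and, if_true]
      rw [← Finset.card_filter]
      have e : (univ.filter fun r : Fin T → Fin n => ∀ t, rot (r t).val y ∈ E) =
          Fintype.piFinset fun _ : Fin T => univ.filter fun s : Fin n => rot s.val y ∈ E := by
        ext r
        simp [Fintype.mem_piFinset]
      rw [e, Fintype.card_piFinset, Finset.prod_const, Finset.card_univ, Fintype.card_fin]
      rfl
  have hbound : a ^ T * ∑ r, cnt r ≤ (b * n) ^ T * 2 ^ n := by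
    rw [hswap, Finset.mul_sum]
    calc ∑ y ∈ univ.filter (fun y : Fin n → Bool => ¬ b * n ≤ a * rcnt E y), a ^ T * rcnt E y ^ T
        ≤ ∑ y ∈ univ.filter (fun y : Fin n → Bool => ¬ b * n ≤ a * rcnt E y), (b * n) ^ T :=
          Finset.sum_le_sum fun y hy => by
            have hl := (Finset.mem_filter.mp hy).2
            rw [← mul_pow]
            exact Nat.pow_le_pow_left (by omega) T
      _ ≤ ∑ y : Fin n → Bool, (b * n) ^ T :=
          Finset.sum_le_sum_of_subset_of_nonneg (Finset.subset_univ _) fun _ _ _ => Nat.zero_le _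
      _ = (b * n) ^ T * 2 ^ n := by
          rw [Finset.sum_const, Finset.card_univ, Fintype.card_fun, Fintype.card_bool, Fintype.card_fin,
            smul_eq_mul, mul_comm]
  have hne : (univ : Finset (Fin T → Fin n)).Nonempty := ⟨fun _ => ⟨0, hn⟩, mem_univ _⟩
  have hsum : ∑ r ∈ (univ : Finset (Fin T → Fin n)), a ^ T * cnt r ≤
      ∑ r ∈ (univ : Finset (Fin T → Fin n)), b ^ T * 2 ^ n := by
    rw [← Finset.mul_sum, Finset.sum_const, Finset.card_univ, Fintype.card_fun, Fintype.card_fin,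
      Fintype.card_fin, smul_eq_mul]
    calc a ^ T * ∑ r, cnt r ≤ (b * n) ^ T * 2 ^ n := hbound
      _ = n ^ T * (b ^ T * 2 ^ n) := by rw [mul_pow]; ring
  obtain ⟨r, _, hr⟩ := Finset.exists_le_of_sum_le hne hsum
  exact ⟨fun t => (r t).val, hr⟩

/-- Bernoulli: `2·θ^θ ≤ (θ+1)^θ` for `θ ≥ 1` (over `ℝ`). -/
theorem two_mul_pow_le_succ_pow {θ : ℕ} (hθ : 1 ≤ θ) :
    2 * (θ : ℝ) ^ θ ≤ ((θ : ℝ) + 1) ^ θ := by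
  have hθr : (0 : ℝ) < θ := by exact_mod_cast hθ
  have hb : 1 + (θ : ℝ) * (1 / θ) ≤ (1 + 1 / (θ : ℝ)) ^ θ :=
    one_add_mul_le_pow (by have : (0 : ℝ) ≤ 1 / (θ : ℝ) := by positivity
                           linarith) θ
  have h2 : (2 : ℝ) ≤ (1 + 1 / (θ : ℝ)) ^ θ := by
    have : (θ : ℝ) * (1 / θ) = 1 := by field_simp
    linarith [hb]
  have heq : ((θ : ℝ) + 1) ^ θ = (θ : ℝ) ^ θ * (1 + 1 / (θ : ℝ)) ^ θ := by
    rw [← mul_pow]; congr 1; field_simp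
  rw [heq]
  have hpos : (0 : ℝ) ≤ (θ : ℝ) ^ θ := by positivity
  nlinarith [mul_le_mul_of_nonneg_left h2 hpos]

/-- `(log₂(n+6))^c ≤ (log₂ n)^{2c}` for `n ≥ 8`. -/
theorem log_pad_le (c : ℕ) {n : ℕ} (hn : 8 ≤ n) : (Nat.log 2 (n + 6)) ^ c ≤ (Nat.log 2 n) ^ (2 * c) := by
  have h1 : Nat.log 2 (n + 6) ≤ Nat.log 2 n + 1 :=
    calc Nat.log 2 (n + 6) ≤ Nat.log 2 (n * 2) := Nat.log_mono_right (by omega)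
      _ = Nat.log 2 n + 1 := Nat.log_mul_base (by norm_num) (by omega)
  have h2 : 2 ≤ Nat.log 2 n := Nat.le_log_of_pow_le (by norm_num) (le_trans (by norm_num) hn)
  calc (Nat.log 2 (n + 6)) ^ c ≤ (Nat.log 2 n + 1) ^ c := Nat.pow_le_pow_left h1 c
    _ ≤ (Nat.log 2 n * Nat.log 2 n) ^ c := Nat.pow_le_pow_left (by nlinarith) c
    _ = (Nat.log 2 n) ^ (2 * c) := by rw [← pow_two, ← pow_mul]

/-- **THE HINGE FROM THE ORBIT-HEAVY HULL.**  `HeavyCover3 → InvModCover3` with both statements inlined (hypothesis =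
the list-free, word-free single-ring statement «every sparse polylog-degree event admits a rotation-invariant
polylog-degree dense `φ` missing all but `2ⁿ/n^{k'}` of its orbit-heavy strings, at an orbit fraction `θ/(θ+1)` of the
prover's choosing»; conclusion = the covering dichotomy of part 11 verbatim): fix the word `W0`, pass to the body event
`E = {y : ψ(pad W0 y) ≠ 1}`, split `Bad` into orbit-light (random list, `exists_rotList₂ (θ+1) θ`) and orbit-heavy
(the hypothesis' `φ`). -/
theorem steerDial_invModCover3_of_heavyCover3
    (hH :
      ∀ ηI : ℝ, 0 < ηI → ∃ η : ℝ, 0 < η ∧ ∀ k' c : ℕ, ∃ θ c' n₀ : ℕ, 1 ≤ θ ∧ ∀ n ≥ n₀,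
        ∀ g : Smolensky.CubeFn (ZMod 3) n, g ∈ Smolensky.lowDeg (ZMod 3) n ((Nat.log 2 n) ^ c) →
          (((univ.filter fun y : Fin n → Bool => g y ≠ 1).card : ℝ) ≤ η * (2 : ℝ) ^ n) →
            ∃ φ : Smolensky.CubeFn (ZMod 3) n, φ ∈ Smolensky.lowDeg (ZMod 3) n ((Nat.log 2 n) ^ c') ∧
              (∀ y : Fin n → Bool, φ (rot 1 y) = φ y) ∧
                (1 - ηI) * (2 : ℝ) ^ n ≤ ((univ.filter fun y : Fin n → Bool => φ y = 1).card : ℝ) ∧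
                  ((univ.filter fun y : Fin n → Bool =>
                      φ y = 1 ∧ θ * n ≤ (θ + 1) * rcnt (univ.filter fun y' : Fin n → Bool => g y' ≠ 1) y).card : ℝ) ≤
                    1 / (n : ℝ) ^ k' * (2 : ℝ) ^ n) :
  ∀ ηI : ℝ, 0 < ηI → ∃ η : ℝ, 0 < η ∧ ∀ k' : ℕ, ∃ m : ℕ, 1 ≤ m ∧ ∃ c₁ : ℕ, ∀ c : ℕ, ∃ c' : ℕ, ∃ n₀ : ℕ, ∀ n ≥ n₀,
    ∀ ψ : Smolensky.CubeFn (ZMod 3) (n + m), ψ ∈ Smolensky.lowDeg (ZMod 3) (n + m) ((Nat.log 2 (n + m)) ^ c) →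
      (1 - η) * (2 : ℝ) ^ (n + m) ≤ ((univ.filter fun x : Fin (n + m) → Bool => ψ x = 1).card : ℝ) →
        ∃ T : ℕ, T ≤ (Nat.log 2 n) ^ c₁ ∧ ∃ r : Fin T → ℕ, ∃ u α β : Fin T → Fin m → Bool, ∃ a b : Fin T → Bool,
          (∀ t, wordCert (u t) (α t) (β t) (a t) (b t) = true) ∧
            ∃ φ : Smolensky.CubeFn (ZMod 3) n, φ ∈ Smolensky.lowDeg (ZMod 3) n ((Nat.log 2 n) ^ c') ∧
              (∀ y : Fin n → Bool, φ (rot 1 y) = φ y) ∧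
                (1 - ηI) * (2 : ℝ) ^ n ≤ ((univ.filter fun y : Fin n → Bool => φ y = 1).card : ℝ) ∧
                  ((univ.filter fun y : Fin n → Bool =>
                      φ y = 1 ∧ ∀ t : Fin T, ψ (pad (u t) (rot (r t) y)) ≠ 1).card : ℝ) ≤
                    1 / (n : ℝ) ^ k' * (2 : ℝ) ^ n := by
  classical
  intro ηI hηI
  obtain ⟨η, hη, hmain⟩ := hH ηI hηI
  refine ⟨η / 64, by positivity, fun k' => ⟨6, by norm_num, 2, fun c => ?_⟩⟩
  obtain ⟨θ, c', n₁, hθ, hcov⟩ := hmain (k' + 1) (2 * c)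
  refine ⟨c', max n₁ (2 ^ (2 * θ * (k' + 1) + 3)), ?_⟩
  intro n hn ψ hψ hdens
  have hn₁ : n₁ ≤ n := le_trans (le_max_left _ _) hn
  have hn2 : 2 ^ (2 * θ * (k' + 1) + 3) ≤ n := le_trans (le_max_right _ _) hn
  set L := Nat.log 2 n with hL
  have hLk : 2 * θ * (k' + 1) + 3 ≤ L := by rw [hL]; exact Nat.le_log_of_pow_le (by norm_num) hn2
  have h8 : 8 ≤ 2 ^ (2 * θ * (k' + 1) + 3) := by
    calc (8 : ℕ) = 2 ^ 3 := by norm_num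
      _ ≤ 2 ^ (2 * θ * (k' + 1) + 3) := Nat.pow_le_pow_right (by norm_num) (by omega)
  have hn8 : 8 ≤ n := le_trans h8 hn2
  have hn0 : 0 < n := by omega
  -- the body event of the fixed word `W0` (kept opaque)
  obtain ⟨E, hE⟩ : ∃ E : Finset (Fin n → Bool), E = univ.filter fun y : Fin n → Bool => ψ (pad W0 y) ≠ 1 :=
    ⟨_, rfl⟩
  have hEdef : ∀ y, y ∈ E ↔ ψ (pad W0 y) ≠ 1 := fun y => by rw [hE]; simp
  have hg : (fun y => ψ (pad W0 y) : Smolensky.CubeFn (ZMod 3) n) ∈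
      Smolensky.lowDeg (ZMod 3) n (L ^ (2 * c)) :=
    Smolensky.lowDeg_mono (log_pad_le c hn8) (comp_pad_mem_lowDegG W0 hψ)
  -- sparsity: `#E ≤ #{ψ ≠ 1} ≤ (η/64)·2^{n+6} = η·2ⁿ`
  have hEcard : (E.card : ℝ) ≤ η * 2 ^ n := by
    have hinj : E.card ≤ (univ.filter fun x : Fin (n + 6) → Bool => ¬ ψ x = 1).card := by
      refine Finset.card_le_card_of_injOn (fun y => pad W0 y) (fun y hy => ?_) (fun a _ b _ hab => ?_)
      · have hy' := (hEdef y).mp (Finset.mem_coe.mp hy)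
        exact Finset.mem_coe.mpr (Finset.mem_filter.mpr ⟨Finset.mem_univ _, hy'⟩)
      · funext i
        have := congrArg (fun x => x (Fin.castAdd 6 i)) hab
        simpa using this
    have hsplit := Finset.card_filter_add_card_filter_not (s := (univ : Finset (Fin (n + 6) → Bool)))
      (fun x => ψ x = 1)
    have huniv : (univ : Finset (Fin (n + 6) → Bool)).card = 2 ^ (n + 6) := by
      rw [Finset.card_univ, Fintype.card_fun, Fintype.card_bool, Fintype.card_fin]
    have h1 : (((univ.filter fun x : Fin (n + 6) → Bool => ¬ ψ x = 1).card : ℕ) : ℝ) =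
        2 ^ (n + 6) - ((univ.filter fun x : Fin (n + 6) → Bool => ψ x = 1).card : ℝ) := by
      have := congrArg (fun k : ℕ => (k : ℝ)) hsplit
      simp only [Nat.cast_add, huniv, Nat.cast_pow, Nat.cast_ofNat] at this
      linarith
    have h2 : (E.card : ℝ) ≤ ((univ.filter fun x : Fin (n + 6) → Bool => ¬ ψ x = 1).card : ℝ) := by
      exact_mod_cast hinj
    have h5 : (2 : ℝ) ^ (n + 6) = 2 ^ n * 64 := by rw [pow_add]; norm_num
    rw [h1, h5] at h2
    rw [h5] at hdens
    linarith
  have hEcard' : (((univ.filter fun y : Fin n → Bool => ψ (pad W0 y) ≠ 1).card : ℕ) : ℝ) ≤ η * 2 ^ n := by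
    rw [← hE]; exact hEcard
  -- the orbit-heavy hull
  obtain ⟨φ, hdeg, hinv, hdense, hheavy⟩ := hcov n hn₁ (fun y => ψ (pad W0 y)) hg hEcard'
  rw [← hE] at hheavy
  -- the random rotation list
  obtain ⟨M, hM⟩ : ∃ M : ℕ, M = k' * (L + 1) + 1 := ⟨_, rfl⟩
  obtain ⟨T, hT⟩ : ∃ T : ℕ, T = θ * M := ⟨_, rfl⟩
  have hTL : T ≤ L ^ 2 := by
    have h1 : T ≤ θ * (k' + 1) * (L + 1) := by rw [hT, hM]; nlinarith
    have h2 : 2 * (θ * (k' + 1) * (L + 1)) ≤ (L - 3) * (L + 1) := by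
      have h3 : 2 * θ * (k' + 1) ≤ L - 3 := by omega
      nlinarith [Nat.mul_le_mul_right (L + 1) h3]
    have h4 : (L - 3) * (L + 1) ≤ 2 * L ^ 2 := by nlinarith [Nat.sub_le L 3]
    nlinarith
  have hnM : 2 * n ^ k' ≤ 2 ^ M := by
    have hlt : n < 2 ^ (L + 1) := by rw [hL]; exact Nat.lt_pow_succ_log_self (by norm_num) n
    calc 2 * n ^ k' ≤ 2 * (2 ^ (L + 1)) ^ k' := Nat.mul_le_mul_left _ (Nat.pow_le_pow_left hlt.le k')
      _ = 2 ^ M := by rw [hM]; ring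
  -- `2·n^{k'}·θ^T ≤ (θ+1)^T` (Bernoulli, `T = θ·M`, `2^M ≥ 2n^{k'}`)
  have hθT : 2 * (n : ℝ) ^ k' * (θ : ℝ) ^ T ≤ ((θ : ℝ) + 1) ^ T := by
    have hB := two_mul_pow_le_succ_pow hθ
    have hθ0 : (0 : ℝ) ≤ (θ : ℝ) ^ θ := by positivity
    have h1 : (2 * (θ : ℝ) ^ θ) ^ M ≤ (((θ : ℝ) + 1) ^ θ) ^ M :=
      pow_le_pow_left₀ (by positivity) hB M
    have h2 : (2 : ℝ) * n ^ k' ≤ 2 ^ M := by exact_mod_cast hnM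
    calc 2 * (n : ℝ) ^ k' * (θ : ℝ) ^ T ≤ 2 ^ M * (θ : ℝ) ^ T :=
          mul_le_mul_of_nonneg_right h2 (by positivity)
      _ = (2 * (θ : ℝ) ^ θ) ^ M := by rw [hT, mul_pow, pow_mul]
      _ ≤ (((θ : ℝ) + 1) ^ θ) ^ M := h1
      _ = ((θ : ℝ) + 1) ^ T := by rw [hT, pow_mul]
  obtain ⟨r, hr⟩ := exists_rotList₂ (θ + 1) θ hn0 E T
  refine ⟨T, hTL, r, fun _ => W0, fun _ => A0, fun _ => B0, fun _ => false, fun _ => false,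
    fun _ => wordCert_W0, φ, hdeg, hinv, hdense, ?_⟩
  -- `Bad ∩ {φ = 1} ⊆ (light ∩ Bad) ∪ (major ∩ {φ = 1})`
  have hsub : (univ.filter fun y : Fin n → Bool => φ y = 1 ∧ ∀ t : Fin T, ψ (pad W0 (rot (r t) y)) ≠ 1) ⊆
      (univ.filter fun y : Fin n → Bool => ¬ θ * n ≤ (θ + 1) * rcnt E y ∧ ∀ t, rot (r t) y ∈ E) ∪
        (univ.filter fun y : Fin n → Bool => φ y = 1 ∧ θ * n ≤ (θ + 1) * rcnt E y) := by
    intro y hy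
    simp only [Finset.mem_filter, Finset.mem_univ, true_and, Finset.mem_union] at hy ⊢
    by_cases hh : θ * n ≤ (θ + 1) * rcnt E y
    · exact Or.inr ⟨hy.1, hh⟩
    · exact Or.inl ⟨hh, fun t => (hEdef _).mpr (hy.2 t)⟩
  have hcardle := (Finset.card_le_card hsub).trans (Finset.card_union_le _ _)
  obtain ⟨A, hA⟩ : ∃ A : ℕ,
      A = (univ.filter fun y : Fin n → Bool =>
        ¬ θ * n ≤ (θ + 1) * rcnt E y ∧ ∀ t, rot (r t) y ∈ E).card := ⟨_, rfl⟩
  obtain ⟨B, hBdef⟩ : ∃ B : ℕ,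
      B = (univ.filter fun y : Fin n → Bool => φ y = 1 ∧ θ * n ≤ (θ + 1) * rcnt E y).card := ⟨_, rfl⟩
  rw [← hA] at hr
  rw [← hA, ← hBdef] at hcardle
  rw [← hBdef] at hheavy
  have hn2r : (2 : ℝ) ≤ n := by exact_mod_cast (show 2 ≤ n by omega)
  have hP0 : (0 : ℝ) < (n : ℝ) ^ k' := by positivity
  have hA' : (A : ℝ) * (2 * (n : ℝ) ^ k') ≤ 2 ^ n := by
    -- `(θ+1)^T·A ≤ θ^T·2ⁿ` and `2n^{k'}θ^T ≤ (θ+1)^T`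
    have hrR : ((θ : ℝ) + 1) ^ T * A ≤ (θ : ℝ) ^ T * 2 ^ n := by exact_mod_cast hr
    have hθpos : (0 : ℝ) < (θ : ℝ) ^ T := by
      have : (0 : ℝ) < θ := by exact_mod_cast hθ
      positivity
    have hA0 : (0 : ℝ) ≤ A := Nat.cast_nonneg _
    have h1 : (A : ℝ) * (2 * (n : ℝ) ^ k') * (θ : ℝ) ^ T ≤ ((θ : ℝ) + 1) ^ T * A := by
      nlinarith [mul_le_mul_of_nonneg_left hθT hA0]
    exact le_of_mul_le_mul_right (by nlinarith) hθpos
  have hB' : (B : ℝ) * ((n : ℝ) * (n : ℝ) ^ k') ≤ 2 ^ n := by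
    have hB1 : (B : ℝ) ≤ 1 / (n : ℝ) ^ (k' + 1) * 2 ^ n := hheavy
    rw [one_div, inv_mul_eq_div, le_div_iff₀ (by positivity)] at hB1
    rw [← pow_succ']
    exact hB1
  have h1 : (((univ.filter fun y : Fin n → Bool =>
      φ y = 1 ∧ ∀ t : Fin T, ψ (pad W0 (rot (r t) y)) ≠ 1).card : ℕ) : ℝ) ≤ A + B := by
    exact_mod_cast hcardle
  rw [one_div, inv_mul_eq_div, le_div_iff₀ hP0]
  have hB0 : (0 : ℝ) ≤ (B : ℝ) * (n : ℝ) ^ k' := by positivity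
  have e2 : (B : ℝ) * (n : ℝ) ^ k' * 2 ≤ (B : ℝ) * (n : ℝ) ^ k' * n := by
    nlinarith [mul_nonneg hB0 (sub_nonneg.mpr hn2r)]
  nlinarith [mul_le_mul_of_nonneg_right h1 hP0.le]

end Heavy

end Summit.QuantumAdvantage.QuantumAdvantage.Theorems.SteerDial
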